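import Summits.QuantumFields.YangMills.Theorems.IsotropyFromPowerCountingEngineFromPowerCounting
import HarnessLib

/-!
# The engine and the sub-problem from `CurvatureDensities` IN PLACE OF `TemperedCurvatureMoments`

Support file for the item `IsotropyFromPowerCounting.CurvatureDensities` (stmt-QuantumFields-17723).

The route's certified split is `EngineFromPowerCounting : T → Σ → B′` (stmt-17722, landed
`engineFromPowerCounting_proof`), where the crux T = `TemperedCurvatureMoments` enters ONLY through Step 0,
`T → CurvatureDensities` (landed `curvatureDensities_of_temperedCurvatureMoments`).  This file records the
sharper, kernel-checked form of that observation: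

* `softKernelBoostCovariance_of_curvatureDensities` — `CurvatureDensities → CurvatureSandwichBound →
  MirrorModularBoosts.SoftKernelBoostCovariance`: the item `CurvatureDensities` (Step 0 itself, strictly weaker than
  T as a statement) is EXACTLY the Yang–Mills regularity input the landed engine `cruxOfInputsK` consumes (its kernel
  antecedent idle), so in the engine T may be replaced by the item;
* `yangMills_of_curvatureDensitiesRP` — consequently the sub-problem `YangMills` follows from the route's items with
  T replaced by `CurvatureDensities`: `Σ, CurvatureDensities, K, H_RP, C ⊢ YangMills` (FOLD 2026-08-31: the universal
  D is an aside; the leg H_RP = `WeakCouplingHypercubicLimitRP` carries diagonal RP at its witness), through the parent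
  route's certified chain `MirrorModularBoosts.closes` exactly as in this route's deciding theorem;
* `yangMills_of_curvatureDensities` — DEPRECATED pre-FOLD form `Σ, CurvatureDensities, K, D, H⁺, C ⊢ YangMills`, kept
  (append-only) with `D`, `H⁺` read as the parent route's aside decls `MirrorModularBoosts.DiagonalMirrorRPR` /
  `MirrorModularBoosts.WeakCouplingHypercubicLimit` (byte-identical to this route's dropped copies) and re-proved through
  `weakCouplingHypercubicLimitRP_of_diagonalMirrorRPR` (`D → H⁺ → H_RP`: the universal D applied to the W₁ package of the
  witness, exactly the third mirror-line case of the pre-FOLD `closes`).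

Planner information (not a route edit): the deciding bet T of the route can be weakened to the `L¹` Step-0 residual
`CurvatureDensities`; by the sibling support files the residual is false model-blindly, needs the tie at order 4, holds
on the tame sector of schemes, and is equivalent to its restriction to the wild sector `|c_k| → ∞`, `β_k ≠ 0`.

References: K. Osterwalder, R. Schrader, Comm. Math. Phys. 42 (1975) §4; H.-J. Borchers, Comm. Math. Phys. 143 (1992).
-/

noncomputable section

namespace Summit.QuantumFields.YangMills.Theorems.CurvatureDensities

open Summit.QuantumFields.YangMills.Theses.IsotropyFromPowerCounting
open Summit.QuantumFields.YangMills.Theses.MirrorModularBoosts (DiagonalMirrorRPR WeakCouplingHypercubicLimit)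
open Summit.QuantumFields.YangMills.Theorems.SoftKernelBoostCovariance.Sketch
  (cruxOfInputsK sandwichBound_planeRot_of_curvatureSandwichBound)

/-- **The engine from Step 0 and Σ.**  `CurvatureDensities → CurvatureSandwichBound →
MirrorModularBoosts.SoftKernelBoostCovariance`, by the landed composition `cruxOfInputsK` of line `Sketch` of crux
stmt-QuantumFields-14999 (Step 0 with its idle kernel antecedent supplied by the item; Σ in `planeRot` vocabulary by
the landed `sandwichBound_planeRot_of_curvatureSandwichBound`).  So T enters the route's engine only through the
item. -/
theorem softKernelBoostCovariance_of_curvatureDensities (hCD : CurvatureDensities) (hSig : CurvatureSandwichBound) :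
    Summit.QuantumFields.YangMills.Theses.MirrorModularBoosts.SoftKernelBoostCovariance :=
  cruxOfInputsK (fun G _ _ _ _ _ _ hG r sch S₁ hW h8 hC _ => hCD G hG r sch S₁ hW h8 hC)
    (sandwichBound_planeRot_of_curvatureSandwichBound hSig)

/-- **Pre-FOLD bridge `D → H⁺ → H_RP`** (parent route's decls): the universal diagonal-mirror crux
`MirrorModularBoosts.DiagonalMirrorRPR` (an aside since the FOLD, 2026-08-31) applied to the W₁ package of the
weak-coupling witness of `MirrorModularBoosts.WeakCouplingHypercubicLimit` (the package is read off the witness's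
HypercubicLimit clauses by the landed `curvatureChannel_proof`) yields the FOLD crux
`MirrorModularBoosts.WeakCouplingHypercubicLimitRP` — verbatim the third mirror-line case of the pre-FOLD deciding
theorem.  Pure logic; recorded so that the deprecated `yangMills_of_curvatureDensities` keeps a proof. -/
theorem weakCouplingHypercubicLimitRP_of_diagonalMirrorRPR (hD : DiagonalMirrorRPR)
    (hH : WeakCouplingHypercubicLimit) :
    Summit.QuantumFields.YangMills.Theses.MirrorModularBoosts.WeakCouplingHypercubicLimitRP := by
  intro G _ _ _ _ hG
  letI : MeasurableSpace G := borel G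
  haveI : BorelSpace G := ⟨rfl⟩
  obtain ⟨r, sch, S, hweak, hW⟩ := hH G hG
  obtain ⟨hW₁, -⟩ := _root_.Summit.QuantumFields.YangMills.Theorems.curvatureChannel_proof G hG r sch S hW
  exact ⟨r, sch, S, hweak, fun R a b ha hb hR => hD G hG r sch _ hW₁ R a b ha hb hR, hW⟩

/-- **`YangMills` from the route's items with T replaced by `CurvatureDensities`**:
`Σ, CurvatureDensities, K, D, H⁺, C ⊢ YangMills` — the parent route's certified chain `MirrorModularBoosts.closes`
fed with the engine `softKernelBoostCovariance_of_curvatureDensities`, exactly as in this route's deciding theorem but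
without `TemperedCurvatureMoments`.
DEPRECATED (FOLD 2026-08-31; use `yangMills_of_curvatureDensitiesRP`): `D` and `H⁺` are now the parent route's aside
decls (this route's byte-identical copies were dropped at rev 6); proof re-routed through
`weakCouplingHypercubicLimitRP_of_diagonalMirrorRPR`. -/
theorem yangMills_of_curvatureDensities (hSig : CurvatureSandwichBound) (hCD : CurvatureDensities)
    (hK : CurvatureKernelBound) (hD : DiagonalMirrorRPR) (hH : WeakCouplingHypercubicLimit)
    (hC : PlanarSpectralCone) : YangMills :=
  Summit.QuantumFields.YangMills.Theses.MirrorModularBoosts.closes hK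
    (softKernelBoostCovariance_of_curvatureDensities hCD hSig) hC
    (weakCouplingHypercubicLimitRP_of_diagonalMirrorRPR hD hH)

/-- **`YangMills` from the route's items with T replaced by `CurvatureDensities`** (FOLD form, 2026-08-31):
`Σ, CurvatureDensities, K, H_RP, C ⊢ YangMills` — the universal D is an aside; the existence leg
`H_RP = WeakCouplingHypercubicLimitRP` carries the diagonal-frame RP at its own witness.  The parent route's certified
chain `MirrorModularBoosts.closes` (rev ≥ 19) fed with the engine `softKernelBoostCovariance_of_curvatureDensities`,
exactly as in this route's deciding theorem but without `TemperedCurvatureMoments`. -/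
theorem yangMills_of_curvatureDensitiesRP (hSig : CurvatureSandwichBound) (hCD : CurvatureDensities)
    (hK : CurvatureKernelBound) (hH : WeakCouplingHypercubicLimitRP)
    (hC : PlanarSpectralCone) : YangMills :=
  Summit.QuantumFields.YangMills.Theses.MirrorModularBoosts.closes hK
    (softKernelBoostCovariance_of_curvatureDensities hCD hSig) hC hH

end Summit.QuantumFields.YangMills.Theorems.CurvatureDensities

end
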